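import Literature.AnabelianGeometry.EtaleTheta.ThetaRootOrbitsOfSetting
import HarnessLib

/-!
# [EtTh] §2 Def 2.7 at the §1 model: the cyclotome comparison `Δ_Θ ≅ ι(toTheta⁻¹Δ_Θ)/ι(Ker toTheta)` of
# `ThetaOrbitData.ofEmbedding` is a group isomorphism compatible with the conjugation actions, and
# transported classes separate cohomology classes

Mochizuki, *The Étale Theta Function …* [EtTh], Publ. RIMS 45 (2009), §2, Def 2.7 / Cor 2.8, PRIMS PDF
pp.41–42 (bib key `MochizukiEtTh2009`): the orbits of `η̈^Θ ∈ H¹(Π^tp_Ÿ, Δ_Θ)`, with `Δ_Θ` "a subquotient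
of `Π^tp_C`" on which the automorphisms of Cor 2.8 act.

PROOF-ONLY companion (no `def`; seat abc-iut-L2-t2) of `ThetaRootOrbitsOfSetting.lean` (the constructor
`ThetaCovers.ThetaOrbitData.ofEmbedding` along an `OrbitEmbedding ε`, `ι : Π^tp_X ↪ Π^tp_C = T.Gtp`).
Kernel-checked API for its consumers (Cor 2.8 (i)/(iii) model rows, abc-iut-L2-d3's instantiation):

* `coeffOf_mul`, `coeffOf_injective`, `coeffOf_surjective`, `exists_mulEquiv_coeffOf` — the comparison
  map `coeffOf : Δ_Θ → top/bot` is a multiplicative bijection (so the cyclotome of the orbit data IS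
  abc-iut-L2-t1's `Δ_Θ`);
* `act_coeffOf` — it intertwines the conjugation action of `g ∈ Π^tp_X` on `Δ_Θ` (through `toTheta`)
  with `ThetaOrbitData.act (ι g)` on `top/bot` (the action entering `twist`/`EqUpToRootOfUnity`);
* `transport_injective`, `transport_mem_classOf`, `eq_of_classOf_eq` — the transport of cocycles is
  injective and `classOf x = classOf x' → x = x'`: the orbit collections of `ofEmbedding` are faithful
  images of the `H¹`-orbits of abc-iut-L2-t1 and abc-iut-L2-t8.

HONEST FRAMING: [EtTh] is refereed; no side is taken on [IUTchIII] Cor 3.12; nothing beyond the displayed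
statements is claimed.
-/

noncomputable section

namespace Literature.AnabelianGeometry.EtaleTheta

open Literature.AnabelianGeometry.SemiGraphs ThetaCovers

universe u

namespace ThetaSetting.EtaleThetaData.DoubleUnderline.OrbitEmbedding

variable {p : ℕ} [Fact p.Prime] {D : ThetaSetting p} {E : D.EtaleThetaData} {l : ℕ}
  {C : E.DoubleUnderline l} {T : TemperedCoverData.{u} l} (ε : C.OrbitEmbedding T)

/-! ### `coeffOf : Δ_Θ → top/bot` is a multiplicative bijection -/

/-- `ι(g · g') ∈ top` for lifts `g, g'` of elements of `Δ_Θ`. [cite: MochizukiEtTh2009, Def 2.7 p.41] -/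
theorem ι_mul_lift_mem_top (d d' : ↥D.DeltaTheta) : ε.ι (lift d * lift d') ∈ ε.top := by
  rw [map_mul]
  exact ε.top.mul_mem (ε.ι_lift_mem_top d) (ε.ι_lift_mem_top d')

/-- `coeffOf` is multiplicative. [cite: MochizukiEtTh2009, Def 2.7 p.41] -/
theorem coeffOf_mul [hb : ε.bot.Normal] (d d' : ↥D.DeltaTheta) :
    ε.coeffOf (d * d') = ε.coeffOf d * ε.coeffOf d' := by
  have hmul : ε.coeffOf d * ε.coeffOf d' =
      (((⟨ε.ι (lift d), ε.ι_lift_mem_top d⟩ * ⟨ε.ι (lift d'), ε.ι_lift_mem_top d'⟩ : ↥ε.top)) : ε.Coeff) :=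
    (QuotientGroup.mk_mul _ _ _).symm
  have hval : (⟨ε.ι (lift d), ε.ι_lift_mem_top d⟩ * ⟨ε.ι (lift d'), ε.ι_lift_mem_top d'⟩ : ↥ε.top) =
      ⟨ε.ι (lift d * lift d'), ε.ι_mul_lift_mem_top d d'⟩ :=
    Subtype.ext (by simp only [Subgroup.coe_mul, map_mul])
  rw [hmul, hval]
  exact ε.coeffOf_eq_mk (by rw [map_mul, toTheta_lift, toTheta_lift, Subgroup.coe_mul]) _

/-- `coeffOf 1 = 1`. [cite: MochizukiEtTh2009, Def 2.7 p.41] -/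
theorem coeffOf_one [hb : ε.bot.Normal] : ε.coeffOf 1 = 1 := by
  have h1 : ε.ι 1 ∈ ε.top := by rw [map_one]; exact one_mem _
  rw [ε.coeffOf_eq_mk (g := 1) (by rw [map_one, Subgroup.coe_one]) h1]
  have : (⟨ε.ι 1, h1⟩ : ↥ε.top) = 1 := Subtype.ext (by simp only [map_one, Subgroup.coe_one])
  rw [this, QuotientGroup.mk_one]

/-- `coeffOf` is injective: `ι(lift d)⁻¹ ι(lift d') ∈ ι(Ker toTheta)` forces `d = d'` (`ι` injective).
[cite: MochizukiEtTh2009, Def 2.7 p.41] -/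
theorem coeffOf_injective : Function.Injective ε.coeffOf := by
  intro d d' h
  have h' : ((⟨ε.ι (lift d), ε.ι_lift_mem_top d⟩ : ↥ε.top) : ε.Coeff) =
      ((⟨ε.ι (lift d'), ε.ι_lift_mem_top d'⟩ : ↥ε.top) : ε.Coeff) := h
  rw [QuotientGroup.eq, Subgroup.mem_subgroupOf] at h'
  obtain ⟨k, hk, hk'⟩ := Subgroup.mem_map.1 h'
  have hkv : k = (lift d)⁻¹ * lift d' :=
    ε.injective_ι (by rw [hk', map_mul, map_inv]; rfl)
  have h1 : D.toTheta ((lift d)⁻¹ * lift d') = 1 := by rw [← hkv]; exact (MonoidHom.mem_ker).1 hk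
  rw [map_mul, map_inv, toTheta_lift, toTheta_lift, inv_mul_eq_one] at h1
  exact Subtype.ext h1

/-- `coeffOf` is surjective: every element of `top = ι(toTheta⁻¹Δ_Θ)` is `ι g` with `toTheta g ∈ Δ_Θ`.
[cite: MochizukiEtTh2009, Def 2.7 p.41] -/
theorem coeffOf_surjective : Function.Surjective ε.coeffOf := by
  intro a
  obtain ⟨t, rfl⟩ := QuotientGroup.mk_surjective a
  obtain ⟨g, hg, hgt⟩ := Subgroup.mem_map.1 t.2
  refine ⟨⟨D.toTheta g, Subgroup.mem_comap.1 hg⟩, ?_⟩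
  have ht : t = ⟨ε.ι g, hgt ▸ t.2⟩ := Subtype.ext hgt.symm
  rw [ht]
  exact ε.coeffOf_eq_mk rfl _

/-- **The cyclotome of `ofEmbedding` IS `Δ_Θ`**: `coeffOf` underlies a group isomorphism
`Δ_Θ ≃* top/bot`. [cite: MochizukiEtTh2009, Def 2.7 p.41] -/
theorem exists_mulEquiv_coeffOf [hb : ε.bot.Normal] :
    ∃ e : ↥D.DeltaTheta ≃* ε.Coeff, ∀ d, e d = ε.coeffOf d :=
  ⟨MulEquiv.ofBijective (MonoidHom.mk' ε.coeffOf ε.coeffOf_mul)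
      ⟨ε.coeffOf_injective, ε.coeffOf_surjective⟩,
    fun _ => rfl⟩

/-! ### Compatibility with the conjugation actions -/

/-- **`coeffOf` intertwines the conjugation actions**: for `g ∈ Π^tp_X` and `d ∈ Δ_Θ`,
`act (ι g) (coeffOf d) = coeffOf (toTheta(g) d toTheta(g)⁻¹)`, where `act` is the conjugation action of
`Π^tp_C` on the subquotient `top/bot` (`ThetaOrbitData.act`). [cite: MochizukiEtTh2009, Cor 2.8(i) p.42] -/
theorem act_coeffOf (hC : D.Compat) (hS : D.Sec2Hyps) (g : D.PiTemp) (d : ↥D.DeltaTheta) :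
    (ThetaOrbitData.ofEmbedding ε hC hS).act (ε.ι g) (ε.coeffOf d) =
      ε.coeffOf (MulAut.conjNormal (D.toTheta g) d) := by
  haveI : ε.top.Normal := ε.normal_top
  have hmem' : ε.ι g * ε.ι (lift d) * (ε.ι g)⁻¹ ∈ ε.top :=
    (inferInstance : ε.top.Normal).conj_mem _ (ε.ι_lift_mem_top d) (ε.ι g)
  have hmem : ε.ι (g * lift d * g⁻¹) ∈ ε.top := by rwa [map_mul, map_mul, map_inv]
  have key : (ThetaOrbitData.ofEmbedding ε hC hS).act (ε.ι g) (ε.coeffOf d) =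
      ((⟨ε.ι g * ε.ι (lift d) * (ε.ι g)⁻¹, hmem'⟩ : ↥ε.top) : ε.Coeff) := rfl
  have hval : (⟨ε.ι g * ε.ι (lift d) * (ε.ι g)⁻¹, hmem'⟩ : ↥ε.top) = ⟨ε.ι (g * lift d * g⁻¹), hmem⟩ :=
    Subtype.ext (by simp only [map_mul, map_inv])
  refine key.trans ?_
  rw [hval]
  exact (ε.coeffOf_eq_mk (by rw [map_mul, map_mul, map_inv, toTheta_lift, MulAut.conjNormal_apply]) hmem).symm

/-! ### Transport is injective; transported classes separate classes -/

/-- The transport of functions `Π^tp_Ÿ → Δ_Θ` to functions `T.PiYddtp → top/bot` is injective.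
[cite: MochizukiEtTh2009, Def 2.7 p.41] -/
theorem transport_injective : Function.Injective ε.transport := by
  intro f f' h
  funext g
  have hg := congrFun h ⟨ε.ι g, ε.map_GtpYdd.le ⟨g, g.2, rfl⟩⟩
  change ε.coeffOf (f (ε.pull _)) = ε.coeffOf (f' (ε.pull _)) at hg
  rw [ε.pull_ι] at hg
  exact ε.coeffOf_injective hg

/-- A class contains the transport of each of its representatives. [cite: MochizukiEtTh2009, Def 2.7 p.41] -/
theorem transport_mem_classOf (f : ↥(contCocycles D.toTheta D.DeltaTheta D.GtpYdd)) :
    ε.transport f.1 ∈ ε.classOf (ContH1.mk f.1 f.2) :=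
  ⟨f, rfl, rfl⟩

/-- `classOf x` is non-empty. [cite: MochizukiEtTh2009, Def 2.7 p.41] -/
theorem classOf_nonempty (x : D.H1 D.GtpYdd) : (ε.classOf x).Nonempty := by
  obtain ⟨f, rfl⟩ := QuotientGroup.mk_surjective x
  exact ⟨_, ε.transport_mem_classOf f⟩

/-- **Transported classes separate cohomology classes**: `classOf x = classOf x' → x = x'` (so the
orbit collections of `ofEmbedding` are faithful images of the `H¹`-orbits).
[cite: MochizukiEtTh2009, Def 2.7 p.41] -/
theorem eq_of_classOf_eq {x x' : D.H1 D.GtpYdd} (h : ε.classOf x = ε.classOf x') : x = x' := by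
  obtain ⟨f, rfl⟩ := QuotientGroup.mk_surjective x
  have hf : ε.transport f.1 ∈ ε.classOf x' := h ▸ ε.transport_mem_classOf f
  obtain ⟨f', hf', hff'⟩ := hf
  have : f = f' := Subtype.ext (ε.transport_injective hff')
  rw [this]
  exact hf'

/-- Hence the transported orbit collection `orbitColl S` is in bijection with the set of classes
`{s·η̈^Θ | s ∈ S}`: two conjugates give the same member iff they are the same class.
[cite: MochizukiEtTh2009, Def 2.7 p.41] -/
theorem classOf_eq_classOf_iff {x x' : D.H1 D.GtpYdd} : ε.classOf x = ε.classOf x' ↔ x = x' :=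
  ⟨ε.eq_of_classOf_eq, fun h => h ▸ rfl⟩

end ThetaSetting.EtaleThetaData.DoubleUnderline.OrbitEmbedding

end Literature.AnabelianGeometry.EtaleTheta

end

-- (re-land 2026-08-26T07:58Z: enqueue build after the ThetaCovers v3 reload window; declarations byte-identical)
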